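import Mathlib
import Literature.AlgebraicGeometry.Resolution.LogChartMonomialLemmas
import Literature.AlgebraicGeometry.Resolution.KummerConeFaces
import Literature.AlgebraicGeometry.Resolution.KummerChartLogRegular
import Literature.AlgebraicGeometry.Resolution.KummerToricDivisorial
import Literature.AlgebraicGeometry.Resolution.MinimalGeneratorsIndependent
import Literature.AlgebraicGeometry.Resolution.RegularLocalRingsNormal
import Summits.ResolutionOfSingularities.ResolutionOfSingularities.Theorems.PAlterationPicoverLocalModelNormalizationGlue
import Summits.ResolutionOfSingularities.ResolutionOfSingularities.Theorems.PAlterationPicoverLocalModelKummerToricClosure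

/-!
# Crux `PicoverLocalModel` (stmt-ResolutionOfSingularities-0557), line `SketchIdeator3`
# (giraud-cossart-normal-form) — endgame, local charts: Kato's condition and the divisorial
# monoid at a Kummer point of the normalised cover

Helper of the stub `stub_localCharts`. The Kummer chart `Φ : P = kummerCone p j₀ c → Γ(Y^ν, V)`
of the normalised `p`-cyclic cover is built at a Kummer CENTRE `w` from the twisted form
`a - g^p = u₁^p x^A` (`c = c₀ A mod p`, `c₀ A_{j₀} ≡ 1`); it must be log regular at EVERY prime
of the chart ring, i.e. at every point `w'` near `w`, where only the boundary equations `x_j`,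
`j ∈ J = {j | x_j ∈ 𝔪_{w'}}`, vanish. This file does the case where some `j₁ ∈ J` has
`p ∤ A_{j₁}` (`isLogRegularLocal_of_kummerForm`): over `O = 𝒪_{W,w'}` the radicand is again in
twisted Kummer form for the sub-family `x|_J` (absorb the unit `∏_{j ∉ J} x_j^{A_j}` by a
second twist at the pivot `j₁`), so the local ring `N` of the normalised cover is the toric
algebra `T'` of that sub-family (`integralClosure_model_eq_range_toric` and the glue
`exists_algEquiv_of_integralClosure_eq_range`); the chart values `ψ(v)` (`ψ(v)^p = x^{e(v)}`) and
the values of the chart of `T'` agree up to units in both directions (`exists_mem_kummerCone_extend`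
and the divisorial description `divisorialMonoid_toric` of `T'`), so Kato's ideal of `ψ` is the
monomial ideal of `T'`, `N/I ≅ O/(x_J)` is regular, the face of units has rank `r - #J`
(`finrank_span_face_kummerCone`), and the divisorial monoid of the boundary is generated by
units and `ψ(P)` (Kato 1994, Def. (2.1), Thm. 11.6).
-/

noncomputable section

-- single-problem summit: the doubled namespace component `ResolutionOfSingularities` is the tree layout
set_option linter.dupNamespace false

open IsLocalRing Polynomial Literature.AlgebraicGeometry.Resolution

namespace Summit.ResolutionOfSingularities.ResolutionOfSingularities.Theorems.PicoverLocalModel.LocalCharts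

universe u

/-- The divisorial monoid is transported by ring isomorphisms. [folklore] -/
theorem divisorialMonoid_map_ringEquiv {R S : Type*} [CommRing R] [CommRing S] (e : R ≃+* S)
    (I : Ideal R) :
    (divisorialMonoid I).map e.toMonoidHom = divisorialMonoid (I.map (e : R →+* S)) := by
  ext g
  constructor
  · rintro ⟨g, hg, rfl⟩
    rw [SetLike.mem_coe, mem_divisorialMonoid_iff_forall_isPrime] at hg
    rw [mem_divisorialMonoid_iff_forall_isPrime]
    intro 𝔭 h𝔭 hg𝔭
    have h := hg (𝔭.comap (e : R →+* S)) (Ideal.comap_isPrime _ _)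
      (by rw [Ideal.mem_comap]; exact hg𝔭)
    exact Ideal.map_le_iff_le_comap.mpr h
  · intro hg
    refine ⟨e.symm g, ?_, by simp⟩
    rw [mem_divisorialMonoid_iff_forall_isPrime] at hg
    rw [SetLike.mem_coe, mem_divisorialMonoid_iff_forall_isPrime]
    intro 𝔮 h𝔮 hg𝔮
    have h := hg (𝔮.comap (e.symm : S →+* R)) (Ideal.comap_isPrime _ _)
      (by rw [Ideal.mem_comap]; exact hg𝔮)
    rw [Ideal.map_le_iff_le_comap] at h
    intro y hy
    have := h hy
    rw [Ideal.mem_comap, Ideal.mem_comap] at this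
    simpa using this

/-- Units and a chart image are transported by ring isomorphisms. [folklore] -/
theorem map_sup_mrange_ringEquiv {R S M : Type*} [CommRing R] [CommRing S] [Monoid M]
    (e : R ≃+* S) (φ : M →* R) :
    (IsUnit.submonoid R ⊔ MonoidHom.mrange φ).map e.toMonoidHom =
      IsUnit.submonoid S ⊔ MonoidHom.mrange (e.toMonoidHom.comp φ) := by
  rw [Submonoid.map_sup, MonoidHom.map_mrange]
  congr 1
  ext y
  constructor
  · rintro ⟨x, hx, rfl⟩
    exact (IsUnit.mem_submonoid_iff _).mpr (((IsUnit.mem_submonoid_iff _).mp hx).map _)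
  · intro hy
    refine ⟨e.symm y, (IsUnit.mem_submonoid_iff _).mpr ?_, by simp⟩
    exact ((IsUnit.mem_submonoid_iff _).mp hy).map e.symm

/-- A natural inverse of `A` modulo the prime `p`, for `p ∤ A`. [folklore] -/
theorem exists_mul_mod_eq_one {p : ℕ} [hp : Fact p.Prime] {A : ℕ} (hA : ¬ p ∣ A) :
    ∃ c : ℕ, c * A % p = 1 := by
  have hA0 : (A : ZMod p) ≠ 0 := fun h => hA ((ZMod.natCast_eq_zero_iff A p).mp h)
  refine ⟨((A : ZMod p)⁻¹).val, ?_⟩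
  have h1 : ((((A : ZMod p)⁻¹).val * A : ℕ) : ZMod p) = ((1 : ℕ) : ZMod p) := by
    rw [Nat.cast_mul, ZMod.natCast_zmod_val, inv_mul_cancel₀ hA0, Nat.cast_one]
  have := (ZMod.natCast_eq_natCast_iff' _ 1 p).mp h1
  rwa [Nat.mod_eq_of_lt hp.out.one_lt] at this

/-- **Kato's condition and the divisorial monoid at a Kummer point.** See the module
docstring. [cite: Kato1994, Def. (2.1) and Thm. 11.6] -/
theorem isLogRegularLocal_of_kummerForm : ∀ {O N : Type u} [CommRing O] [IsRegularLocalRing O] (p : ℕ) [Fact p.Prime] [CharP O p] [CommRing N] [IsDomain N] [IsIntegrallyClosed N] [Algebra O N] [Algebra.IsIntegral O N] {r : ℕ} (x : Fin r → O) (A : Fin r → ℕ) (j₀ : Fin r) (c₀ : ℕ), c₀ * A j₀ % p = 1 → (∀ (s : ℕ) (σ : Fin s → Fin r), Function.Injective σ → (∀ i, x (σ i) ∈ IsLocalRing.maximalIdeal O) → ∀ α : Fin s → O, ∑ i, α i * x (σ i) ∈ IsLocalRing.maximalIdeal O ^ 2 → ∀ i, α i ∈ IsLocalRing.maximalIdeal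 O) → (∃ j₁, x j₁ ∈ IsLocalRing.maximalIdeal O ∧ ¬ p ∣ A j₁) → ∀ (a g u₁ : O), IsUnit u₁ → a - g ^ p = u₁ ^ p * ∏ j, x j ^ A j → ∀ [IsDomain (AdjoinRoot ((Polynomial.X : Polynomial O) ^ p - Polynomial.C a))] (t : N), t ^ p = algebraMap O N a → Function.Injective (algebraMap O N) → (∀ z : N, ∃ d : O, d ≠ 0 ∧ ∃ q : Polynomial O, algebraMap O N d * z = Polynomial.aeval t q) → ∀ (ψ : Multiplicative (kummerCone p j₀ (fun j => c₀ * A j % p)) →* N), (∀ v : kummerCone p j₀ (fun j => c₀ * A j % p), ψ (Multiplicative.ofAdd v) ^ p = algebraMap O N (∏ j, x j ^ (kummerExp p j₀ (fun j => c₀ * A j % p) v j).toNat)) → IsLocalRing N ∧ LogChart.IsLogRegularLocal (kummerCone p j₀ (fun j => c₀ * A j % p)) ψ ∧ divisorialMonoid (Ideal.span {algebraMap O N (∏ j, x j)}) = IsUnit.submonoid N ⊔ MonoidHom.mrange ψ := by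
  intro O N _ _ p _ _ _ _ _ _ _ r x A j₀ c₀ hc₀ hli hpiv a g u₁ hu₁ ha _ t ht hinj hbir ψ hψ
  classical
  obtain ⟨j₁, hj₁, hpA⟩ := hpiv
  have hp : p.Prime := Fact.out
  haveI := isDomain_of_isRegularLocalRing O
  -- the coordinates through the point
  set J : Finset (Fin r) := Finset.univ.filter fun j => x j ∈ maximalIdeal O with hJdef
  have hJ : ∀ j, j ∈ J ↔ x j ∈ maximalIdeal O := fun j => by simp [hJdef]
  have hxu : ∀ j, j ∉ J → IsUnit (x j) := fun j hj =>
    IsLocalRing.notMem_maximalIdeal.mp ((hJ j).not.mp hj)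
  set s : ℕ := J.card with hsdef
  let σ' : Fin s ≃ J := J.equivFin.symm
  let σ : Fin s → Fin r := fun i => (σ' i : Fin r)
  have hσinj : Function.Injective σ := fun i i' h => σ'.injective (Subtype.ext h)
  have hσmem : ∀ i, x (σ i) ∈ maximalIdeal O := fun i => (hJ _).mp (σ' i).2
  have hσJ : ∀ i, σ i ∈ J := fun i => (σ' i).2
  have hσsurj : ∀ j, j ∈ J → ∃ i, σ i = j := fun j hj =>
    ⟨σ'.symm ⟨j, hj⟩, by simp [σ]⟩
  have hσout : ∀ j, (∀ i, σ i ≠ j) ↔ j ∉ J := fun j =>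
    ⟨fun h hj => by obtain ⟨i, hi⟩ := hσsurj j hj; exact h i hi,
     fun hj i hi => hj (hi ▸ hσJ i)⟩
  obtain ⟨i₁, hi₁⟩ := hσsurj j₁ ((hJ j₁).mpr hj₁)
  -- the second twist at the pivot `j₁`
  obtain ⟨c₁, hc₁⟩ := exists_mul_mod_eq_one (p := p) hpA
  set m₁ : ℕ := c₁ * A j₁ / p with hm₁def
  have hm₁ : c₁ * A j₁ = p * m₁ + 1 := by
    have := Nat.div_add_mod (c₁ * A j₁) p
    rw [hc₁] at this
    rw [hm₁def]
    exact this.symm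
  set v' : O := ∏ j ∈ Jᶜ, x j ^ A j with hv'def
  have hv' : IsUnit v' :=
    IsUnit.prod_iff.mpr fun j hj => (hxu j (Finset.mem_compl.mp hj)).pow _
  let ε : Fin s → O := fun i => if i = i₁ then v' ^ c₁ else 1
  have hε : ∀ i, IsUnit (ε i) := fun i => by
    simp only [ε]; split_ifs
    · exact hv'.pow _
    · exact isUnit_one
  let x'' : Fin s → O := fun i => ε i * x (σ i)
  have hx'' : ∀ i, x'' i ∈ maximalIdeal O := fun i => Ideal.mul_mem_left _ _ (hσmem i)
  have hli'' : ∀ α : Fin s → O, ∑ i, α i * x'' i ∈ maximalIdeal O ^ 2 →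
      ∀ i, α i ∈ maximalIdeal O :=
    hli_comp_of_injective (u := fun i => x (σ i)) (hli s σ hσinj hσmem) id
      Function.injective_id ε hε
  let u'' : O := u₁ * (↑(hv'.unit⁻¹) : O) ^ m₁
  have hu'' : IsUnit u'' := hu₁.mul ((Units.isUnit _).pow _)
  -- the product over all coordinates splits as `v' · ∏_{i} x_{σ i}^{A_{σ i}}`
  have hsplit : ∀ E : Fin r → ℕ,
      ∏ j, x j ^ E j = (∏ j ∈ Jᶜ, x j ^ E j) * ∏ i, x (σ i) ^ E (σ i) := by
    intro E
    rw [← Finset.prod_compl_mul_prod J]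
    congr 1
    rw [← Finset.prod_coe_sort J]
    exact (Fintype.prod_equiv σ' (fun i => x (σ i) ^ E (σ i)) (fun j => x j ^ E j)
      (fun i => rfl)).symm
  have hA'' : a - g ^ p = u'' ^ p * ∏ i, x'' i ^ A (σ i) := by
    have h1 : ∏ i, x'' i ^ A (σ i) = v' ^ (c₁ * A j₁) * ∏ i, x (σ i) ^ A (σ i) := by
      simp only [x'', mul_pow, Finset.prod_mul_distrib]
      congr 1
      rw [Finset.prod_eq_single i₁ (fun i _ hi => by simp [ε, hi]) (by simp)]
      simp [ε, hi₁, pow_mul]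
    rw [ha, hsplit A, h1, ← hv'def, hm₁]
    have hvinv : (↑(hv'.unit⁻¹) : O) * v' = 1 := hv'.val_inv_mul
    calc u₁ ^ p * (v' * ∏ i, x (σ i) ^ A (σ i))
        = u₁ ^ p * ((↑(hv'.unit⁻¹) : O) * v') ^ (p * m₁) * (v' * ∏ i, x (σ i) ^ A (σ i)) := by
          rw [hvinv, one_pow, mul_one]
      _ = u'' ^ p * (v' ^ (p * m₁ + 1) * ∏ i, x (σ i) ^ A (σ i)) := by
          simp only [u'']
          ring
  -- the toric model over `O` and the glue
  have hc₁' : c₁ * (fun i => A (σ i)) i₁ % p = 1 := by simp only [hi₁]; exact hc₁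
  set c'' : Fin s → ℕ := fun i => c₁ * A (σ i) % p with hc''def
  have hc'' : c'' i₁ = 1 := by simp only [hc''def, hi₁]; exact hc₁
  obtain ⟨ψ', hψ'inj, hrange, -⟩ := integralClosure_model_eq_range_toric p x'' hx'' hli'' i₁
    (fun i => A (σ i)) c₁ hc₁' a g u'' hu''.ne_zero hA''
  have hmonic : ((X : O[X]) ^ p - C a).Monic := monic_X_pow_sub_C a hp.ne_zero
  have ht' : aeval t ((X : O[X]) ^ p - C a) = 0 := by
    rw [map_sub, map_pow, aeval_X, aeval_C, ht, sub_self]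
  obtain ⟨e⟩ := exists_algEquiv_of_integralClosure_eq_range _ hmonic t ht' hinj hbir ψ' hψ'inj
    hrange
  -- `e : N ≃ₐ[O] T''`, `T'' = RootCover.toric p x'' i₁ c''`
  change N ≃ₐ[O] RootCover.toric p x'' i₁ c'' at e
  obtain ⟨hlocT, hdomT, -, hregT, hdimT⟩ :=
    RootCover.toric_structure (p := p) (x := x'') (j₀ := i₁) (c := c'') hx'' hli''
  haveI := hlocT
  haveI hlocN : IsLocalRing N :=
    IsLocalRing.of_surjective' (e.symm : RootCover.toric p x'' i₁ c'' →+* N) e.symm.surjective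
  -- units coming from `O`
  have hunit : ∀ y : O, IsUnit (algebraMap O N y) ↔ IsUnit y := fun y => by
    rw [← isUnit_algebraMap_iff_of_isIntegral (C := RootCover.toric p x'' i₁ c'') y,
      ← e.commutes y]
    exact (isUnit_map_iff e _).symm
  -- the transported model chart `χ`
  let eR : RootCover.toric p x'' i₁ c'' ≃+* N := e.symm.toRingEquiv
  let χ : Multiplicative (kummerCone p i₁ c'') →* N :=
    eR.toMonoidHom.comp (RootCover.toricChart p x'' i₁ c'' hc'')
  have hχ : ∀ w, χ w = eR (RootCover.toricChart p x'' i₁ c'' hc'' w) := fun w => rfl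
  have heR : ∀ y : O, eR (algebraMap O _ y) = algebraMap O N y := fun y => e.symm.commutes y
  -- `p`-th powers of the two charts
  have hψp : ∀ v : kummerCone p j₀ (fun j => c₀ * A j % p),
      ψ (Multiplicative.ofAdd v) ^ p =
        algebraMap O N ((∏ j ∈ Jᶜ, x j ^ (kummerExp p j₀ (fun j => c₀ * A j % p) v j).toNat) *
          ∏ i, x (σ i) ^ (kummerExp p j₀ (fun j => c₀ * A j % p) v (σ i)).toNat) := by
    intro v
    rw [hψ v, hsplit]
  have hχp : ∀ w : kummerCone p i₁ c'',
      χ (Multiplicative.ofAdd w) ^ p =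
        algebraMap O N (v' ^ (c₁ * (kummerExp p i₁ c'' w i₁).toNat) *
          ∏ i, x (σ i) ^ (kummerExp p i₁ c'' w i).toNat) := by
    intro w
    rw [hχ, ← map_pow, RootCover.toricChart_pow_p, heR, toAdd_ofAdd]
    congr 1
    have hnat : ∀ i, RootCover.natExp p i₁ c'' w i = (kummerExp p i₁ c'' w i).toNat := fun i => rfl
    simp only [hnat, x'', mul_pow, Finset.prod_mul_distrib]
    congr 1
    rw [Finset.prod_eq_single i₁ (fun i _ hi => by simp [ε, hi]) (by simp)]
    simp only [ε, if_true, ← pow_mul, kummerExp_apply_self]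
  -- non-vanishing
  have hxσ0 : ∀ i, x (σ i) ≠ 0 := fun i h0 =>
    RegularParameters.notMem_sq (hli s σ hσinj hσmem) i (h0 ▸ Ideal.zero_mem _)
  have hχne : ∀ w : kummerCone p i₁ c'', χ (Multiplicative.ofAdd w) ≠ 0 := by
    intro w h0
    have h := hχp w
    rw [h0, zero_pow hp.ne_zero, eq_comm, map_eq_zero_iff _ hinj] at h
    exact mul_ne_zero (pow_ne_zero _ hv'.ne_zero)
      (Finset.prod_ne_zero_iff.mpr fun i _ => pow_ne_zero _ (hxσ0 i)) h
  -- (C1) every model chart value is a chart value, up to a unit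
  have hC1 : ∀ w : kummerCone p i₁ c'', ∃ v : kummerCone p j₀ (fun j => c₀ * A j % p),
      ∃ γ : N, IsUnit γ ∧ ψ (Multiplicative.ofAdd v) = γ * χ (Multiplicative.ofAdd w) := by
    intro w
    obtain ⟨v, hvP, hvσ, hvout⟩ := exists_mem_kummerCone_extend j₀ A c₀ hc₀ σ hσinj i₁ c₁ hc₁'
      (w : Fin s → ℤ) w.2
    refine ⟨⟨v, hvP⟩, ?_⟩
    refine exists_isUnit_mul_of_pow_eq_unit_mul_pow hp.ne_zero isUnit_one (hχne w) ?_
    rw [one_mul, hψp, hχp]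
    set n : ℕ := (kummerExp p i₁ c'' (w : Fin s → ℤ) i₁).toNat with hndef
    have hn : (kummerExp p i₁ c'' (w : Fin s → ℤ) i₁) = (n : ℤ) :=
      (Int.toNat_of_nonneg (w.2 i₁)).symm
    congr 1
    congr 1
    · rw [hv'def, ← Finset.prod_pow]
      refine Finset.prod_congr rfl fun j hj => ?_
      rw [← pow_mul]
      congr 1
      have hj' : ∀ i, σ i ≠ j := (hσout j).mpr (Finset.mem_compl.mp hj)
      change (kummerExp p j₀ (fun j => c₀ * A j % p) v j).toNat = _
      rw [hvout j hj', hn]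
      rw [show ((A j : ℤ) * (c₁ : ℤ) * (n : ℤ)) = ((A j * (c₁ * n) : ℕ) : ℤ) by push_cast; ring,
        Int.toNat_natCast]
    · refine Finset.prod_congr rfl fun i _ => ?_
      congr 1
      change (kummerExp p j₀ (fun j => c₀ * A j % p) v (σ i)).toNat = _
      rw [hvσ i]
  -- the boundary ideal: `∏_j x_j` and `∏_i x''_i` generate the same ideal of `N`
  set x₀ : N := algebraMap O N (∏ j, x j) with hx₀def
  have hspan : Ideal.span {x₀} = Ideal.span {algebraMap O N (∏ i, x'' i)} := by
    have h1 : ∏ i, x'' i = v' ^ c₁ * ∏ i, x (σ i) := by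
      simp only [x'', Finset.prod_mul_distrib]
      congr 1
      rw [Finset.prod_eq_single i₁ (fun i _ hi => by simp [ε, hi]) (by simp)]
      simp [ε]
    have h2 : ∏ j, x j = (∏ j ∈ Jᶜ, x j) * ∏ i, x (σ i) := by
      have := hsplit (fun _ => 1)
      simpa using this
    apply Ideal.span_singleton_eq_span_singleton.mpr
    have hw : IsUnit (∏ j ∈ Jᶜ, x j) :=
      IsUnit.prod_iff.mpr fun j hj => hxu j (Finset.mem_compl.mp hj)
    refine ⟨((hw.map (algebraMap O N)).unit)⁻¹ * ((hv'.pow c₁).map (algebraMap O N)).unit, ?_⟩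
    rw [hx₀def, h2, h1, map_mul, map_mul, Units.val_mul, IsUnit.unit_spec]
    calc algebraMap O N (∏ j ∈ Jᶜ, x j) * algebraMap O N (∏ i, x (σ i)) *
          (↑(hw.map (algebraMap O N)).unit⁻¹ * algebraMap O N (v' ^ c₁))
        = (↑(hw.map (algebraMap O N)).unit⁻¹ * algebraMap O N (∏ j ∈ Jᶜ, x j)) *
            (algebraMap O N (v' ^ c₁) * algebraMap O N (∏ i, x (σ i))) := by ring
      _ = algebraMap O N (v' ^ c₁) * algebraMap O N (∏ i, x (σ i)) := by
          rw [IsUnit.val_inv_mul, one_mul]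
  -- the divisorial monoid of the boundary, from the toric model
  have hD : divisorialMonoid (Ideal.span {x₀}) = IsUnit.submonoid N ⊔ MonoidHom.mrange χ := by
    rw [hspan, ← heR, show Ideal.span {eR (algebraMap O _ (∏ i, x'' i))} =
      (Ideal.span {algebraMap O (RootCover.toric p x'' i₁ c'') (∏ i, x'' i)}).map
        (eR : RootCover.toric p x'' i₁ c'' →+* N) by rw [Ideal.map_span, Set.image_singleton]; rfl,
      ← divisorialMonoid_map_ringEquiv, RootCover.divisorialMonoid_toric hx'' hli'' hc'',
      map_sup_mrange_ringEquiv]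
  -- (C2) every chart value lies in the divisorial monoid
  have hC2 : ∀ v : kummerCone p j₀ (fun j => c₀ * A j % p),
      ψ (Multiplicative.ofAdd v) ∈ IsUnit.submonoid N ⊔ MonoidHom.mrange χ := by
    intro v
    rw [← hD]
    set E : Fin r → ℕ := fun j => (kummerExp p j₀ (fun j => c₀ * A j % p) v j).toNat with hE
    refine mem_divisorialMonoid_of_dvd_pow (x := x₀) Ideal.le_radical (n := p * ∑ j, E j) ?_
    refine (dvd_pow_self _ hp.ne_zero).trans ?_
    rw [hψ v, hx₀def, ← map_pow]
    refine map_dvd _ ?_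
    rw [pow_mul, ← Finset.prod_pow, ← Finset.prod_pow]
    refine Finset.prod_dvd_prod_of_dvd _ _ fun j _ => ?_
    rw [← pow_mul]
    refine pow_dvd_pow _ ?_
    calc E j ≤ ∑ j, E j := Finset.single_le_sum (fun _ _ => Nat.zero_le _) (Finset.mem_univ j)
      _ ≤ p * ∑ j, E j := Nat.le_mul_of_pos_left _ hp.pos
  -- units and the two chart images generate the same monoid
  have hsup : IsUnit.submonoid N ⊔ MonoidHom.mrange ψ = IsUnit.submonoid N ⊔ MonoidHom.mrange χ := by
    apply le_antisymm
    · refine sup_le le_sup_left ?_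
      rintro _ ⟨w, rfl⟩
      rw [← ofAdd_toAdd w]
      exact hC2 _
    · refine sup_le le_sup_left ?_
      rintro _ ⟨w, rfl⟩
      obtain ⟨v, γ, hγ, hv⟩ := hC1 (Multiplicative.toAdd w)
      rw [ofAdd_toAdd] at hv
      refine Submonoid.mem_sup.mpr ⟨(↑hγ.unit⁻¹ : N), (IsUnit.mem_submonoid_iff _).mpr (Units.isUnit _),
        ψ (Multiplicative.ofAdd v), ⟨Multiplicative.ofAdd v, rfl⟩, ?_⟩
      rw [hv, ← mul_assoc, IsUnit.val_inv_mul, one_mul]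
  -- Kato's ideals agree
  have hnon : LogChart.nonunitIdeal (kummerCone p j₀ (fun j => c₀ * A j % p)) ψ =
      LogChart.nonunitIdeal (kummerCone p i₁ c'') χ := by
    apply le_antisymm
    · refine Ideal.span_le.mpr ?_
      rintro _ ⟨v, hv, rfl⟩
      obtain ⟨y, hy, z, ⟨w, rfl⟩, hyz⟩ := Submonoid.mem_sup.mp (hC2 v)
      have hw : ¬ IsUnit (χ w) := fun h => hv (by
        rw [← hyz]
        exact ((IsUnit.mem_submonoid_iff _).mp hy).mul h)
      change ψ (Multiplicative.ofAdd v) ∈ _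
      rw [← hyz]
      refine Ideal.mul_mem_left _ _ (Ideal.subset_span ⟨Multiplicative.toAdd w, ?_, ?_⟩)
      · change ¬ IsUnit (χ (Multiplicative.ofAdd (Multiplicative.toAdd w)))
        rwa [ofAdd_toAdd]
      · simp
    · refine Ideal.span_le.mpr ?_
      rintro _ ⟨w, hw, rfl⟩
      obtain ⟨v, γ, hγ, hv⟩ := hC1 w
      have hvu : ¬ IsUnit (ψ (Multiplicative.ofAdd v)) := fun h => hw (by
        have : χ (Multiplicative.ofAdd w) = ↑hγ.unit⁻¹ * ψ (Multiplicative.ofAdd v) := by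
          rw [hv, ← mul_assoc, IsUnit.val_inv_mul, one_mul]
        rw [this]
        exact (Units.isUnit _).mul h)
      have : χ (Multiplicative.ofAdd w) = ↑hγ.unit⁻¹ * ψ (Multiplicative.ofAdd v) := by
        rw [hv, ← mul_assoc, IsUnit.val_inv_mul, one_mul]
      change χ (Multiplicative.ofAdd w) ∈ _
      rw [this]
      exact Ideal.mul_mem_left _ _ (Ideal.subset_span ⟨v, hvu, rfl⟩)
  have hnonχ : LogChart.nonunitIdeal (kummerCone p i₁ c'') χ =
      (RootCover.toricIdeal p x'' i₁ c'').map (eR : RootCover.toric p x'' i₁ c'' →+* N) := by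
    change LogChart.nonunitIdeal _ (eR.toMonoidHom.comp _) = _
    rw [LogChart.nonunitIdeal_comp_equiv, RootCover.nonunitIdeal_toricChart hx'' hc'']
  set I : Ideal N := (RootCover.toricIdeal p x'' i₁ c'').map
    (eR : RootCover.toric p x'' i₁ c'' →+* N) with hIdef
  let eQ := Ideal.quotientEquiv (RootCover.toricIdeal p x'' i₁ c'') I eR rfl
  have hregNI : IsRegularLocalRing (N ⧸ I) := @IsRegularLocalRing.of_ringEquiv _ _ hregT _ _ eQ
  have hdimNI : ringKrullDim (N ⧸ I) + s = ringKrullDim N := by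
    rw [← ringKrullDim_eq_of_ringEquiv eQ, ← ringKrullDim_eq_of_ringEquiv eR, hdimT]
  -- the face of units
  have hface : LogChart.unitFace (kummerCone p j₀ (fun j => c₀ * A j % p)) ψ =
      {v : kummerCone p j₀ (fun j => c₀ * A j % p) |
        ∀ j ∈ J, kummerExp p j₀ (fun j => c₀ * A j % p) (v : Fin r → ℤ) j = 0} := by
    ext v
    rw [LogChart.mem_unitFace_iff, ← isUnit_pow_iff hp.ne_zero, hψ v, hunit,
      IsUnit.prod_univ_iff, Set.mem_setOf_eq]
    constructor
    · intro h j hj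
      have hj' := h j
      rw [isUnit_pow_iff_of_not_isUnit ((IsLocalRing.mem_maximalIdeal _).mp ((hJ j).mp hj))]
        at hj'
      have h0 := v.2 j
      omega
    · intro h j
      by_cases hj : j ∈ J
      · rw [h j hj]; simp
      · exact (hxu j hj).pow _
  have hrank := finrank_span_face_kummerCone hp.pos j₀ (fun j => c₀ * A j % p) J
  rw [← hface] at hrank
  have hlog : LogChart.IsLogRegularLocal (kummerCone p j₀ (fun j => c₀ * A j % p)) ψ :=
    LogChart.isLogRegularLocal_of_eq _ ψ I (hnon.trans hnonχ) hregNI s hdimNI hrank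
  exact ⟨hlocN, hlog, hD.trans hsup.symm⟩

end Summit.ResolutionOfSingularities.ResolutionOfSingularities.Theorems.PicoverLocalModel.LocalCharts

end
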